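import Mathlib
import Literature.Computability.AlgebraicComplexity.FixedPointLog
import Summits.RiemannHypothesis.RiemannHypothesis.Theorems.WeilFormatCJointShiftSOS
import Summits.RiemannHypothesis.RiemannHypothesis.Theorems.WeilFormatCJointShiftCert
import Summits.RiemannHypothesis.RiemannHypothesis.Theorems.WeilFormatCJointShiftCertBrackets
import Summits.RiemannHypothesis.RiemannHypothesis.Theorems.WeilFormatCJointShiftCertSound
import Summits.RiemannHypothesis.RiemannHypothesis.Theorems.WeilFormatCCellShiftCert
import Summits.RiemannHypothesis.RiemannHypothesis.Theorems.WeilFormatCCellShiftCertCells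
import Summits.RiemannHypothesis.RiemannHypothesis.Theorems.WeilFormatCCellShiftCertCorr
import HarnessLib

/-!
# Cell-refined shift certificate (route K3): semantics of the class tables and the part sums

Helper file (`--supports stmt-RiemannHypothesis-0098`), RH-free; seat rh-explicit-weil-1 gen3.  The real value `val` of a
class table of the kernel checker `WeilFormatCCellShiftCert.lean` against the piece correlations `X`, the value of the
table of part `j` (`val_table` = window classes + upper-triangular pair pass), its bound by the claimed `dparts[j]·∫f²`
(`val_le_tableBound`), and the summation over the parts (`sum_triSum`: twice the upper triangle of the full Gram pair
terms; `diag_add_upper2`; `diag_eq_sum_massOf`).  The main theorem is in `WeilFormatCCellShiftCertSound.lean`.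
Standard axioms only.
-/

set_option linter.dupNamespace false

noncomputable section

namespace Summit.RiemannHypothesis.RiemannHypothesis.Theorems.WeilFormatC

namespace CellSOS

open MeasureTheory Set Finset JointSOS
open scoped Real BigOperators

namespace Cert

variable (c : Cert) (f : ℝ → ℝ)

/-! ### Semantics of a class table -/

/-- The value of a class table: `Σ_{(κ, v, ws)} (v/4^k + 2 Σ_{ws} wt) · X(κ)`. [folklore] -/
def val : List Entry → ℝ
  | [] => 0
  | (κ, v, ws) :: rest => ((v : ℝ) / (4 : ℝ) ^ c.kbits + 2 * c.toJ.wsum ws) * c.X f κ + val rest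

/-- `ins` adds one term. -/
theorem val_ins (κ : CKey) (v : ℤ) (ws : List WItem) (L : List Entry) :
    c.val f (ins κ v ws L) = c.val f L + ((v : ℝ) / (4 : ℝ) ^ c.kbits + 2 * c.toJ.wsum ws) * c.X f κ := by
  induction L with
  | nil => simp only [ins, val]; ring
  | cons en rest ih =>
      obtain ⟨κ', v', ws'⟩ := en
      simp only [ins]
      by_cases h : κ = κ'
      · subst h
        simp only [if_true, val, JointSOS.Cert.wsum_append]; push_cast; ring
      · simp only [if_neg h, val, ih]; ring

variable (j : ℕ)

/-- The window term of item `w` and cell pair `(k, l)` in part `j`. -/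
def winTerm (w : WItem) (kl : ℕ × ℕ) : ℝ :=
  if !c.adm (uvec w.1 w.2.1) kl.1 kl.2 && decide (c.partOf (uvec w.1 w.2.1, kl.1, kl.2) = j) then
    2 * c.toJ.wt w * c.X f (uvec w.1 w.2.1, kl.1, kl.2) else 0

/-- Value of `windowRow`. -/
theorem val_windowRow (w : WItem) (k : ℕ) (L : List ℕ) (acc : List Entry) :
    c.val f (c.windowRow j w k L acc) = c.val f acc + (L.map fun l ↦ c.winTerm f j w (k, l)).sum := by
  induction L generalizing acc with
  | nil => simp [windowRow]
  | cons l rest ih =>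
      simp only [windowRow, ih, List.map_cons, List.sum_cons, winTerm]
      split_ifs with h
      · rw [val_ins]; simp only [JointSOS.Cert.wsum]; push_cast; ring
      · ring

/-- Value of `windowCells`. -/
theorem val_windowCells (w : WItem) (K : List ℕ) (acc : List Entry) :
    c.val f (c.windowCells j w K acc) = c.val f acc +
      (K.map fun k ↦ ((List.range c.pcells).map fun l ↦ c.winTerm f j w (k, l)).sum).sum := by
  induction K generalizing acc with
  | nil => simp [windowCells]
  | cons k rest ih => rw [windowCells, ih, val_windowRow, List.map_cons, List.sum_cons]; ring

/-- The window value of item `w` in part `j`: `Σ_{k<p} Σ_{l<p} winTerm`. -/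
def winVal (w : WItem) : ℝ :=
  ((List.range c.pcells).map fun k ↦ ((List.range c.pcells).map fun l ↦ c.winTerm f j w (k, l)).sum).sum

/-- Value of `windowEntries`. -/
theorem val_windowEntries (W : List WItem) (acc : List Entry) :
    c.val f (c.windowEntries j W acc) = c.val f acc + (W.map (c.winVal f j)).sum := by
  induction W generalizing acc with
  | nil => simp [windowEntries]
  | cons w rest ih => rw [windowEntries, ih, val_windowCells, List.map_cons, List.sum_cons, winVal]; ring

/-- The pair term of part `j` (class of `(S_β − S_α, l, k)`). -/
def pairTerm (sa sc : ZVec4 × ℕ × List ℤ) : ℝ :=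
  if c.adm (ckey (vsub sc.1 sa.1) sc.2.1 sa.2.1).1 (ckey (vsub sc.1 sa.1) sc.2.1 sa.2.1).2.1
      (ckey (vsub sc.1 sa.1) sc.2.1 sa.2.1).2.2 then 0 else
    if c.partOf (ckey (vsub sc.1 sa.1) sc.2.1 sa.2.1) = j then
      ((2 * dotZ sa.2.2 sc.2.2 : ℤ) : ℝ) / (4 : ℝ) ^ c.kbits * c.X f (ckey (vsub sc.1 sa.1) sc.2.1 sa.2.1)
    else 0

/-- `val_step`. -/
theorem val_step (sa sc : ZVec4 × ℕ × List ℤ) (acc : List Entry) :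
    c.val f (c.step j sa.1 sa.2.1 sa.2.2 sc acc) = c.val f acc + c.pairTerm f j sa sc := by
  unfold step pairTerm
  split_ifs with h1 h2
  · rw [add_zero]
  · rw [val_ins]; simp only [JointSOS.Cert.wsum, mul_zero, add_zero]
  · rw [add_zero]

/-- `innerPass_cons`. -/
theorem innerPass_cons (sa sc : ZVec4 × ℕ × List ℤ) (rest : List (ZVec4 × ℕ × List ℤ)) (acc : List Entry) :
    c.innerPass j sa.1 sa.2.1 sa.2.2 (sc :: rest) acc =
      c.innerPass j sa.1 sa.2.1 sa.2.2 rest (c.step j sa.1 sa.2.1 sa.2.2 sc acc) := by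
  cases hs : c.step j sa.1 sa.2.1 sa.2.2 sc acc <;> simp only [innerPass, hs]

/-- `outerPass_cons`. -/
theorem outerPass_cons (sa : ZVec4 × ℕ × List ℤ) (rest : List (ZVec4 × ℕ × List ℤ)) (acc : List Entry) :
    c.outerPass j (sa :: rest) acc = c.outerPass j rest (c.innerPass j sa.1 sa.2.1 sa.2.2 rest acc) := by
  cases hs : c.innerPass j sa.1 sa.2.1 sa.2.2 rest acc <;> simp only [outerPass, hs]

/-- `val_innerPass`. -/
theorem val_innerPass (sa : ZVec4 × ℕ × List ℤ) (L : List (ZVec4 × ℕ × List ℤ)) (acc : List Entry) :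
    c.val f (c.innerPass j sa.1 sa.2.1 sa.2.2 L acc) = c.val f acc + (L.map (c.pairTerm f j sa)).sum := by
  induction L generalizing acc with
  | nil => simp [innerPass]
  | cons sc rest ih => rw [innerPass_cons, ih, val_step, List.map_cons, List.sum_cons]; ring

/-- The upper-triangular sum of part `j`. -/
def triSum : List (ZVec4 × ℕ × List ℤ) → ℝ
  | [] => 0
  | sa :: rest => (rest.map (c.pairTerm f j sa)).sum + triSum rest

/-- `val_outerPass`. -/
theorem val_outerPass (L : List (ZVec4 × ℕ × List ℤ)) (acc : List Entry) :
    c.val f (c.outerPass j L acc) = c.val f acc + c.triSum f j L := by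
  induction L generalizing acc with
  | nil => simp [outerPass, triSum]
  | cons sa rest ih => rw [outerPass_cons, ih, val_innerPass, triSum]; ring

/-- **Value of the table of part `j`.** -/
theorem val_table :
    c.val f (c.table j) = (c.toJ.witems.map (c.winVal f j)).sum + c.triSum f j c.mc := by
  rw [table, val_outerPass, val_windowEntries]; simp [val]

variable {c f j}

/-- The bound: `val L ≤ tableBound L · ∫ f²`. -/
theorem val_le_tableBound (hh : c.toJ.hintsOK = true) (hl : c.toJ.logsOK = true)
    (hXle : ∀ κ : CKey, |c.X f κ| ≤ ∫ x, f x ^ 2)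
    (L : List Entry) (hL : ∀ en ∈ L, ∀ w ∈ en.2.2, c.toJ.witemOK w = true) :
    c.val f L ≤ (c.tableBound L : ℝ) * ∫ x, f x ^ 2 := by
  have hE : 0 ≤ ∫ x, f x ^ 2 := integral_nonneg fun x ↦ sq_nonneg _
  induction L with
  | nil => simp [val, tableBound]
  | cons en rest ih =>
      obtain ⟨κ, v, ws⟩ := en
      have hws : ∀ w ∈ ws, c.toJ.witemOK w = true := fun w hw ↦ hL (κ, v, ws) (by simp) w hw
      have ih' := ih fun en hen ↦ hL en (List.mem_cons_of_mem _ hen)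
      obtain ⟨hwlo, hwhi⟩ := JointSOS.Cert.wsum_bracket (c := c.toJ) hh hl hws
      rw [show c.val f ((κ, v, ws) :: rest) =
          ((v : ℝ) / (4 : ℝ) ^ c.kbits + 2 * c.toJ.wsum ws) * c.X f κ + c.val f rest from rfl,
        show c.tableBound ((κ, v, ws) :: rest) = c.entryBound (κ, v, ws) + c.tableBound rest from rfl,
        Rat.cast_add, add_mul (c.entryBound (κ, v, ws) : ℝ)]
      refine add_le_add ?_ ih'
      simp only [entryBound]; push_cast
      set t : ℝ := (v : ℝ) / (4 : ℝ) ^ c.kbits + 2 * c.toJ.wsum ws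
      calc t * c.X f κ ≤ |t * c.X f κ| := le_abs_self _
        _ = |t| * |c.X f κ| := abs_mul _ _
        _ ≤ |t| * ∫ x, f x ^ 2 := mul_le_mul_of_nonneg_left (hXle κ) (abs_nonneg _)
        _ ≤ (max |2 * (c.toJ.wLoSum ws : ℝ) + (v : ℝ) / (4 : ℝ) ^ c.kbits|
              |2 * (c.toJ.wHiSum ws : ℝ) + (v : ℝ) / (4 : ℝ) ^ c.kbits|) * ∫ x, f x ^ 2 := by
            refine mul_le_mul_of_nonneg_right ?_ hE
            have e4 : ((4 : ℚ) : ℝ) ^ c.kbits = (4 : ℝ) ^ c.kbits := by norm_num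
            exact abs_le_max_abs_abs (by simp only [t]; linarith) (by simp only [t]; linarith)

/-! ### Summing the parts -/

section Parts

variable (c f)

/-- The full (both orientations) pair term. -/
def fullTerm (sa sc : ZVec4 × ℕ × List ℤ) : ℝ :=
  (dotZ sa.2.2 sc.2.2 : ℝ) / (4 : ℝ) ^ c.kbits * c.X f (vsub sc.1 sa.1, sc.2.1, sa.2.1)

/-- `S_β − S_α = −(S_α − S_β)`. -/
theorem vsub_eq_vneg_vsub (u v : ZVec4) : vsub u v = vneg (vsub v u) := by
  unfold JointSOS.vsub JointSOS.vneg
  refine Prod.ext ?_ (Prod.ext ?_ (Prod.ext ?_ ?_)) <;> simp only <;> ring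

/-- `S_α − S_α = 0`. -/
theorem vsub_self (u : ZVec4) : vsub u u = (0, 0, 0, 0) := by
  unfold JointSOS.vsub
  refine Prod.ext ?_ (Prod.ext ?_ (Prod.ext ?_ ?_)) <;> simp

/-- `fullTerm` is symmetric. -/
theorem fullTerm_symm (sa sc : ZVec4 × ℕ × List ℤ) : c.fullTerm f sa sc = c.fullTerm f sc sa := by
  unfold fullTerm
  rw [JointSOS.Cert.dotZ_comm, vsub_eq_vneg_vsub sc.1 sa.1, X_swap]

variable {c f}

/-- Summed over the parts, the pair term is the doubled full term. -/
theorem sum_pairTerm (hn : 0 < c.nparts)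
    (hXadm : ∀ (γ : ZVec4) (k l : ℕ), k < c.pcells → l < c.pcells → c.adm γ k l = true → c.X f (γ, k, l) = 0)
    (sa sc : ZVec4 × ℕ × List ℤ) (hka : sa.2.1 < c.pcells) (hkc : sc.2.1 < c.pcells) :
    ∑ j ∈ Finset.range c.nparts, c.pairTerm f j sa sc = 2 * c.fullTerm f sa sc := by
  have hX : c.X f (ckey (vsub sc.1 sa.1) sc.2.1 sa.2.1) = c.X f (vsub sc.1 sa.1, sc.2.1, sa.2.1) := X_ckey f _ _ _
  -- the cells of the canonical key are `{sc.2.1, sa.2.1}` in some order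
  have hcells : ((ckey (vsub sc.1 sa.1) sc.2.1 sa.2.1).2.1 < c.pcells ∧
      (ckey (vsub sc.1 sa.1) sc.2.1 sa.2.1).2.2 < c.pcells) := by
    unfold ckey; split_ifs
    · exact ⟨lt_of_le_of_lt (min_le_left _ _) hkc, max_lt hkc hka⟩
    · exact ⟨hkc, hka⟩
    · exact ⟨hka, hkc⟩
  unfold pairTerm fullTerm
  by_cases h : c.adm (ckey (vsub sc.1 sa.1) sc.2.1 sa.2.1).1 (ckey (vsub sc.1 sa.1) sc.2.1 sa.2.1).2.1
      (ckey (vsub sc.1 sa.1) sc.2.1 sa.2.1).2.2 = true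
  · simp only [h, ↓reduceIte, Finset.sum_const_zero]
    have h0 := hXadm _ _ _ hcells.1 hcells.2 h
    rw [← hX, h0]; ring
  · simp only [h, Bool.false_eq_true, ↓reduceIte]
    rw [Finset.sum_ite_eq]
    have : c.partOf (ckey (vsub sc.1 sa.1) sc.2.1 sa.2.1) ∈ Finset.range c.nparts :=
      Finset.mem_range.2 (Nat.mod_lt _ hn)
    rw [if_pos this, hX]; push_cast; ring

/-- Twice the upper triangle of the full pair terms. -/
def upper2 (c : Cert) (f : ℝ → ℝ) : List (ZVec4 × ℕ × List ℤ) → ℝ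
  | [] => 0
  | sa :: rest => (rest.map fun sc ↦ 2 * c.fullTerm f sa sc).sum + upper2 c f rest

/-- The diagonal of the full pair terms. -/
def diag (c : Cert) (f : ℝ → ℝ) : List (ZVec4 × ℕ × List ℤ) → ℝ
  | [] => 0
  | sa :: rest => c.fullTerm f sa sa + diag c f rest

/-- Symmetric completion: diagonal + twice the upper triangle = the full double sum. -/
theorem diag_add_upper2 : ∀ (L : List (ZVec4 × ℕ × List ℤ)),
    diag c f L + upper2 c f L = (L.map fun sa ↦ (L.map fun sc ↦ c.fullTerm f sa sc).sum).sum
  | [] => by simp [diag, upper2]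
  | sa :: rest => by
      rw [diag, upper2]
      have ih := diag_add_upper2 rest
      simp only [List.map_cons, List.sum_cons]
      have h1 : (rest.map fun a ↦ c.fullTerm f a sa + (rest.map fun sc ↦ c.fullTerm f a sc).sum).sum =
          (rest.map fun a ↦ c.fullTerm f sa a).sum +
            (rest.map fun a ↦ (rest.map fun sc ↦ c.fullTerm f a sc).sum).sum := by
        rw [← List.sum_map_add]
        refine congrArg List.sum (List.map_congr_left fun a _ ↦ ?_)
        rw [fullTerm_symm c f a sa]
      have h2 : (rest.map fun sc ↦ 2 * c.fullTerm f sa sc).sum = 2 * (rest.map fun sc ↦ c.fullTerm f sa sc).sum := by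
        rw [List.sum_map_mul_left]
      rw [h1, h2, ← ih]; ring

/-- Summing the triangular part sums over the parts gives `upper2`. -/
theorem sum_triSum (hn : 0 < c.nparts)
    (hXadm : ∀ (γ : ZVec4) (k l : ℕ), k < c.pcells → l < c.pcells → c.adm γ k l = true → c.X f (γ, k, l) = 0) :
    ∀ (L : List (ZVec4 × ℕ × List ℤ)), (∀ sa ∈ L, sa.2.1 < c.pcells) →
      ∑ j ∈ Finset.range c.nparts, c.triSum f j L = upper2 c f L
  | [], _ => by simp [triSum, upper2]
  | sa :: rest, hL => by
      simp only [triSum, upper2, Finset.sum_add_distrib]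
      have hsa : sa.2.1 < c.pcells := hL sa (by simp)
      have hrest : ∀ sc ∈ rest, sc.2.1 < c.pcells := fun sc h ↦ hL sc (List.mem_cons_of_mem _ h)
      rw [sum_triSum hn hXadm rest hrest, JointSOS.Cert.list_sum_finset_sum_comm]
      congr 1
      refine congrArg List.sum (List.map_congr_left fun sc hsc ↦ ?_)
      exact sum_pairTerm hn hXadm sa sc hsa (hrest sc hsc)

/-- The diagonal regrouped by cells: `diag = Σ_{k<p} (massOf k)/4^kbits · ‖f_k‖²`. -/
theorem diag_eq_sum_massOf : ∀ (L : List (ZVec4 × ℕ × List ℤ)), (∀ sa ∈ L, sa.2.1 < c.pcells) →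
    diag c f L = ∑ k ∈ Finset.range c.pcells, (massOf k L : ℝ) / (4 : ℝ) ^ c.kbits * c.X f ((0, 0, 0, 0), k, k)
  | [], _ => by simp [diag, massOf]
  | sa :: rest, hL => by
      have hsa : sa.2.1 < c.pcells := hL sa (by simp)
      have hrest : ∀ sc ∈ rest, sc.2.1 < c.pcells := fun sc h ↦ hL sc (List.mem_cons_of_mem _ h)
      rw [diag, diag_eq_sum_massOf rest hrest]
      simp only [massOf]
      push_cast
      simp only [add_div, add_mul, Finset.sum_add_distrib]
      congr 1
      rw [Finset.sum_eq_single_of_mem sa.2.1 (Finset.mem_range.2 hsa)]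
      · rw [if_pos rfl]; unfold fullTerm
        rw [vsub_self]
      · intro k _ hk; rw [if_neg (Ne.symm hk)]; simp

end Parts

end Cert

end CellSOS

end Summit.RiemannHypothesis.RiemannHypothesis.Theorems.WeilFormatC
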